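/-
Copyright (c) 2026. All rights reserved.
Released under Apache 2.0 license as described in the file LICENSE.
-/
import Literature.Probability.FitznerVanDerHofstad2017.NobleBoundsNMidEProper
import Literature.Probability.FitznerVanDerHofstad2017.NobleBoundsNFirstEProper
import HarnessLib

/-!
# Fitzner–van der Hofstad (2017), §6.1 (6.4) / (5.4) / App. B Table `B^{(2),ι,a,b}`: the row `(1, ≥2 | d ≥ 2)` of term 3 in PRODUCT form (`F″` proper, inner class `2`, start class `1`), middle and first junction

[FvdH17] = R. Fitzner, R. van der Hofstad, *Mean-field behavior for nearest-neighbor percolation in `d > 10`*,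
arXiv:1506.07977v2 (EJP 22 (2017), paper 43).  Page numbers refer to the arXiv version.

Continuation of `NobleBoundsNMidEProper` / `NobleBoundsNFirstEProper` (variant `F″` PROPER: kind bit `true`,
`t_k ≠ u_{k+1}` ((4.58), p. 41), inner class `2`: `t_k ≠ z_k` and the bond `{t_k, z_k}` — if it is one — closed)
to the remaining start class `a_k = 1` (`u_k ∼ w_k`, the exit bond of level `k` is the lattice bond `{u_k, w_k}`):
the row `(1, ≥2 | d_{C̃}(w,u) ≥ 2)` of App. B Table `B^{(2),ι,a,b}` (p. 76).  As printed (and as typed in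
`NobleBlocksNTPrime.blockBNTpt₀'`, summand `c = 2` of row `(1, 2)`) this row is the JOINT pentagon
`p⁻¹ · T_{≥1,≥1,≥2}(y−t, z−t, 0) · P_{≥1,≥0,1̲,1̲,≥0}(x−t, e−t, −t, v−t, z−t)` whose fourth line is the refunded exit
bond `{u_k, w_k}` itself; reading that bond as a line of the junction needs the two-bond kit (`useUW`), which the
b2b-lace packet does not build (K2-DESIGN-MEMO of the packet, line (α)).  This module proves instead the
PRODUCT-FORM bound of the same configurations (line (β′) of the memo, DIVERGENCE/HOLD item K2 of the packet):

  `2dD(w_k − u_k) · T_{≥1,≥1,≥2}(u_{k+1} − t_k, z_k − t_k, 0) · T_{≥1,≥0,1̲}(w_{k+1} − t_k, b̄_k − t_k, u_k − t_k)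
     · τ_{≥0}(z_k − w_k)`,

i.e. the BK inequality applied to THREE groups of bond-disjointly witnessed lines — the triangle
`t_k → u_{k+1} → z_k ⇒ t_k` (slots `3, 4, 2` of level `k + 1`), the chain `t_k → w_{k+1} → b̄_k → u_k` (slots `1, 0`
of level `k + 1` and the pivotal bond `b_k`), the exit line `w_k → z_k` of level `k` — and the indicator
`2dD(w_k − u_k) = 1` of the start class (no `p⁻¹`, the bond `{u_k, w_k}` is not read).  It is an upper bound of the
printed entry's configurations by (4.16)–(4.18) (pp. 35–36) and §6.1 (6.4) (p. 58), weaker than the printed letter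
by exactly the BK split; its numerical price at `d = 11` is accounted on the numerics side of the packet (`k2b`).

§A a four-letter product tool; §B the groupings `glMidK2B` (middle junction: letters `up 2` = triangle, `xb` =
chain with the bond, `lo 5` = exit line) and `glFirstK2B` (first junction: the same plus the start letter `lo 0`,
exit line = slot `lo 3` of the start level) with their (vacuous) (4.65) entry rule and the line readings; §C the
cores via `NobleBoundsNJointKit.nonempty_jPkg_of_joint`; §D the cells `nonempty_jPkg_midE_K2B` /
`nonempty_jPkg_firstE_K2B` (absolute coordinates; empty piece off `a′ = 2` by clause (8) and off the parameter
facts) and their literal base-`u_k` forms `…_lit` at `(u′−u)−(t−u), (z−u)−(t−u), (w′−u)−(t−u), e_κ−(t−u), −(t−u),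
(z−u)−(w−u)` (the argument pattern of the packet's product-form target `tgtK2B`), the first-junction ones behind the
start letter `P^{S,1}(u_0, w_0)` (`NobleBoundsNFirstSOpen.first_startLetter_gl`).

Conventions: `d`-generic; nothing is cited as a fact; additive (no existing declaration is changed); no new
`Prop` definitions.
-/

noncomputable section

namespace Literature.Probability.FitznerVanDerHofstad2017

open Literature.Barriers.CriticalPhenomena Literature.Probability.Percolation
open Literature.Probability.LatticeModels Literature.Combinatorics.SimpleGraph _root_.SimpleGraph
open _root_.MeasureTheory
open Literature.Probability.FitznerVanDerHofstad2017.NobleBlocks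
open Literature.Probability.FitznerVanDerHofstad2017.NobleBlocks.LenIdx
open scoped ENNReal

variable {d : ℕ}

/-! ### A. Tools -/

section Tools

/-- A product of factors `≤ 1` is bounded by the product of any four of them (private helper). [folklore] -/
private theorem prod_le_mul₄_of_le_one {α : Type*} [Fintype α] [DecidableEq α] (X : α → ℝ≥0∞) (hX : ∀ l, X l ≤ 1)
    {l₁ l₂ l₃ l₄ : α} (h₁₂ : l₁ ≠ l₂) (h₁₃ : l₁ ≠ l₃) (h₁₄ : l₁ ≠ l₄) (h₂₃ : l₂ ≠ l₃) (h₂₄ : l₂ ≠ l₄)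
    (h₃₄ : l₃ ≠ l₄) : ∏ l, X l ≤ X l₁ * X l₂ * X l₃ * X l₄ := by
  rw [← Finset.prod_erase_mul _ _ (Finset.mem_univ l₁),
    ← Finset.prod_erase_mul _ _ (Finset.mem_erase.2 ⟨h₁₂.symm, Finset.mem_univ l₂⟩),
    ← Finset.prod_erase_mul _ _ (Finset.mem_erase.2 ⟨h₂₃.symm, Finset.mem_erase.2 ⟨h₁₃.symm, Finset.mem_univ l₃⟩⟩),
    ← Finset.prod_erase_mul _ _ (Finset.mem_erase.2 ⟨h₃₄.symm, Finset.mem_erase.2 ⟨h₂₄.symm,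
      Finset.mem_erase.2 ⟨h₁₄.symm, Finset.mem_univ l₄⟩⟩⟩)]
  calc (∏ l ∈ (((Finset.univ.erase l₁).erase l₂).erase l₃).erase l₄, X l) * X l₄ * X l₃ * X l₂ * X l₁ ≤
      1 * X l₄ * X l₃ * X l₂ * X l₁ := by
        gcongr
        exact Finset.prod_le_one' fun l _ => hX l
    _ = X l₁ * X l₂ * X l₃ * X l₄ := by rw [one_mul]; ring

variable (p : unitInterval) (M : ℕ) (x : Site d) (b : Fin (M + 2) → Site d × Site d) (w t z : Fin (M + 2) → Site d)
  (a : Fin (M + 2) → Fin 3 ⊕ Unit) (τ : Fin (M + 1) → Bool × Fin 3)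

/-- The product of the letters against four designated ones (private helper; the three-letter form is
`NobleBoundsNJointKit.prod_junF_le₃`). [folklore] -/
private theorem prod_junF_le₄ (k : Fin (M + 2)) (gl : JIdx → JIdx) (uB uT : Bool) (ev : JIdx → Set (BondConfig (Site d)))
    {l₁ l₂ l₃ l₄ : JIdx} (h₁₂ : l₁ ≠ l₂) (h₁₃ : l₁ ≠ l₃) (h₁₄ : l₁ ≠ l₄) (h₂₃ : l₂ ≠ l₃) (h₂₄ : l₂ ≠ l₄)
    (h₃₄ : l₃ ≠ l₄) :
    ∏ l, junF p M x b w t z a τ k gl uB uT ev l ≤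
      junF p M x b w t z a τ k gl uB uT ev l₁ * junF p M x b w t z a τ k gl uB uT ev l₂ *
        junF p M x b w t z a τ k gl uB uT ev l₃ * junF p M x b w t z a τ k gl uB uT ev l₄ :=
  prod_le_mul₄_of_le_one _ (junF_le_one p M x b w t z a τ k gl uB uT ev) h₁₂ h₁₃ h₁₄ h₂₃ h₂₄ h₃₄

end Tools

/-! ### B. The groupings and the readings -/

/-- The GROUPING of the product-form row `(1, ≥2 | d ≥ 2)` at a MIDDLE junction: letter `up 2` = {`up 3`, `up 4`,
`up 2`} (the triangle `t → u′ → z ⇒ t`), letter `xb` = {`up 1`, `up 0`, bond} (the chain `t → w′ → b̄ → u`),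
letter `lo 5` = the exit line `w → z` of level `k` (all lower slots; only `lo 5` is active at a middle junction).
[cite: FitznerVanDerHofstad2017, App. B Table "B^{(2),ι,a,b}", row a = 1, b ≥ 2, d_{C̃}(w,u) ≥ 2 and its picture (arXiv:1506.07977v2 p. 76); §4.2 (4.16)–(4.18) (pp. 35–36)] -/
def glMidK2B : JIdx → JIdx
  | .xb => .xb
  | .xtz => .xtz
  | .lo _ => .lo 5
  | .up j => ![JIdx.xb, .xb, .up 2, .up 2, .up 2, .up 5] j

/-- The GROUPING of the product-form row `(1, ≥2 | d ≥ 2)` at the FIRST junction: letter `lo 0` = the start slots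
`0, 1, 2`, letter `lo 3` = the exit line `w_0 → z_0` of the start level, letters `xb`, `up 2` as in `glMidK2B`.
[cite: FitznerVanDerHofstad2017, App. B Table "B^{(2),ι,a,b}", row a = 1, b ≥ 2, d_{C̃}(w,u) ≥ 2 (arXiv:1506.07977v2 p. 76); §5.1 (5.1)–(5.4) (pp. 46–48)] -/
def glFirstK2B : JIdx → JIdx
  | .xb => .xb
  | .xtz => .xtz
  | .lo j => ![JIdx.lo 0, .lo 0, .lo 0, .lo 3, .lo 3, .lo 3] j
  | .up j => ![JIdx.xb, .xb, .up 2, .up 2, .up 2, .up 5] j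

section Grouping

/-- **`glMidK2B` has no cross-level letter**, so the (4.65) entry rule is vacuous for it.
[cite: FitznerVanDerHofstad2017, §4.4 (4.65) and the sentence after it (arXiv:1506.07977v2 p. 43)] -/
theorem glMidK2B_lo_ne_up (j j' : Fin 6) : glMidK2B (.lo j) ≠ glMidK2B (.up j') := by
  fin_cases j' <;> simp [glMidK2B]

/-- **`glFirstK2B` has no cross-level letter**, so the (4.65) entry rule is vacuous for it.
[cite: FitznerVanDerHofstad2017, §4.4 (4.65) and the sentence after it (arXiv:1506.07977v2 p. 43)] -/
theorem glFirstK2B_lo_ne_up (j j' : Fin 6) : glFirstK2B (.lo j) ≠ glFirstK2B (.up j') := by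
  fin_cases j <;> fin_cases j' <;> simp [glFirstK2B]

end Grouping

section Letter

variable (p : unitInterval) (M : ℕ) (x : Site d) (b : Fin (M + 2) → Site d × Site d) (w t z : Fin (M + 2) → Site d)
  (a : Fin (M + 2) → Fin 3 ⊕ Unit) (τ : Fin (M + 1) → Bool × Fin 3)

/-- **Three-line reading of the chain letter `xb`** under `glMidK2B`: `t → w′` (slot `1` of level `k + 1`, read
backwards), `w′ → b̄` (slot `0`, read backwards), `b̄ → u` (the bond `b_k`).
[cite: FitznerVanDerHofstad2017, §4.2 (4.17)–(4.18) (arXiv:1506.07977v2 pp. 35–36); App. B Table "B^{(2),ι,a,b}" row a = 1 (p. 76)] -/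
theorem junF_midK2B_xb_le₃ (i : Fin (M + 1)) (hσ : (τ i).1 = true) {a' : Fin 3} (ha' : a i.succ = Sum.inl a')
    (EB E0 E1 E2 E3 E4 X5 : Set (BondConfig (Site d))) :
    junF p M x b w t z a τ i.castSucc glMidK2B true false (midEv EB E0 E1 E2 E3 E4 X5) .xb ≤
      piPerc d p 2 (genDisjOcc ![E1, E0, EB] ![1, 1, 0]) := by
  refine junF_le_of_lines p M x b w t z a τ i.castSucc glMidK2B true false _ JIdx.xb
    ![JIdx.up 1, .up 0, .xb] (by decide) (fun m => ?_) ![1, 1, 0] (fun m => by fin_cases m <;> rfl)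
    ![E1, E0, EB] (by funext m; fin_cases m <;> rfl)
  fin_cases m
  · exact ⟨(jMidE_act_up_iff M x b w t z a τ i hσ ha' true false 1).2 (by decide), rfl⟩
  · exact ⟨(jMidE_act_up_iff M x b w t z a τ i hσ ha' true false 0).2 (by decide), rfl⟩
  · exact ⟨rfl, rfl⟩

/-- **Three-line reading of the triangle letter `up 2`** under `glMidK2B`: `t → u′` (slot `3`), `u′ → z` (slot `4`),
`z ⇒ t` (slot `2`, read backwards). [cite: FitznerVanDerHofstad2017, §4.2 (4.17) (arXiv:1506.07977v2 p. 36); App. B (p. 76)] -/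
theorem junF_midK2B_up_le₃ (i : Fin (M + 1)) (hσ : (τ i).1 = true) {a' : Fin 3} (ha' : a i.succ = Sum.inl a')
    (EB E0 E1 E2 E3 E4 X5 : Set (BondConfig (Site d))) :
    junF p M x b w t z a τ i.castSucc glMidK2B true false (midEv EB E0 E1 E2 E3 E4 X5) (.up 2) ≤
      piPerc d p 2 (genDisjOcc ![E3, E4, E2] ![1, 1, 1]) := by
  refine junF_le_of_lines p M x b w t z a τ i.castSucc glMidK2B true false _ (JIdx.up 2)
    ![JIdx.up 3, .up 4, .up 2] (by decide) (fun m => ?_) ![1, 1, 1] (fun m => by fin_cases m <;> rfl)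
    ![E3, E4, E2] (by funext m; fin_cases m <;> rfl)
  fin_cases m
  · exact ⟨(jMidE_act_up_iff M x b w t z a τ i hσ ha' true false 3).2 (by decide), rfl⟩
  · exact ⟨(jMidE_act_up_iff M x b w t z a τ i hσ ha' true false 4).2 (by decide), rfl⟩
  · exact ⟨(jMidE_act_up_iff M x b w t z a τ i hσ ha' true false 2).2 (by decide), rfl⟩

/-- **One-line reading of the exit letter `lo 5`** under `glMidK2B` at a middle junction `k = i₀ + 1`: the exit line
`w_k → z_k` of level `k`. [cite: FitznerVanDerHofstad2017, §4.2 (4.10), (4.18) (arXiv:1506.07977v2 p. 35); (4.59)–(4.61) (p. 41)] -/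
theorem junF_midK2B_lo_le₁ (i i₀ : Fin (M + 1)) (hk : i₀.succ = i.castSucc) {a₀ : Fin 3}
    (ha : a i.castSucc = Sum.inl a₀) (EB E0 E1 E2 E3 E4 X5 : Set (BondConfig (Site d))) :
    junF p M x b w t z a τ i.castSucc glMidK2B true false (midEv EB E0 E1 E2 E3 E4 X5) (.lo 5) ≤
      piPerc d p 2 (genDisjOcc ![X5] ![0]) := by
  refine junF_le_of_lines p M x b w t z a τ i.castSucc glMidK2B true false _ (JIdx.lo 5)
    ![JIdx.lo 5] (by decide) (fun m => ?_) ![0] (fun m => by fin_cases m; rfl)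
    ![X5] (by funext m; fin_cases m; rfl)
  fin_cases m
  exact ⟨(jMidOpen_act_lo_iff M x b w t z a τ i i₀ hk ha true false 5).2 rfl, rfl⟩

/-- **Three-line reading of the chain letter `xb`** under `glFirstK2B`: `t_0 → w_1`, `w_1 → b̄_0` (slots `1, 0` of
level `1`, read backwards), `b̄_0 → u_0` (the bond `b_0`).
[cite: FitznerVanDerHofstad2017, §4.2 (4.17)–(4.18) (arXiv:1506.07977v2 pp. 35–36); App. B Table "B^{(2),ι,a,b}" row a = 1 (p. 76)] -/
theorem junF_firstK2B_xb_le₃ (hσ : (τ 0).1 = true) {a' : Fin 3} (ha' : a (0 : Fin (M + 1)).succ = Sum.inl a')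
    (EB X0 X1 X2 X3 E0 E1 E2 E3 E4 : Set (BondConfig (Site d))) :
    junF p M x b w t z a τ (0 : Fin (M + 1)).castSucc glFirstK2B true false (firstEvS EB X0 X1 X2 X3 E0 E1 E2 E3 E4)
        .xb ≤
      piPerc d p 2 (genDisjOcc ![E1, E0, EB] ![1, 1, 0]) := by
  refine junF_le_of_lines p M x b w t z a τ (0 : Fin (M + 1)).castSucc glFirstK2B true false _ JIdx.xb
    ![JIdx.up 1, .up 0, .xb] (by decide) (fun m => ?_) ![1, 1, 0] (fun m => by fin_cases m <;> rfl)
    ![E1, E0, EB] (by funext m; fin_cases m <;> rfl)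
  fin_cases m
  · exact ⟨(jMidE_act_up_iff M x b w t z a τ 0 hσ ha' true false 1).2 (by decide), rfl⟩
  · exact ⟨(jMidE_act_up_iff M x b w t z a τ 0 hσ ha' true false 0).2 (by decide), rfl⟩
  · exact ⟨rfl, rfl⟩

/-- **Three-line reading of the triangle letter `up 2`** under `glFirstK2B`: `t_0 → u_1`, `u_1 → z_0`, `z_0 ⇒ t_0`.
[cite: FitznerVanDerHofstad2017, §4.2 (4.17) (arXiv:1506.07977v2 p. 36); App. B (p. 76)] -/
theorem junF_firstK2B_up_le₃ (hσ : (τ 0).1 = true) {a' : Fin 3} (ha' : a (0 : Fin (M + 1)).succ = Sum.inl a')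
    (EB X0 X1 X2 X3 E0 E1 E2 E3 E4 : Set (BondConfig (Site d))) :
    junF p M x b w t z a τ (0 : Fin (M + 1)).castSucc glFirstK2B true false (firstEvS EB X0 X1 X2 X3 E0 E1 E2 E3 E4)
        (.up 2) ≤
      piPerc d p 2 (genDisjOcc ![E3, E4, E2] ![1, 1, 1]) := by
  refine junF_le_of_lines p M x b w t z a τ (0 : Fin (M + 1)).castSucc glFirstK2B true false _ (JIdx.up 2)
    ![JIdx.up 3, .up 4, .up 2] (by decide) (fun m => ?_) ![1, 1, 1] (fun m => by fin_cases m <;> rfl)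
    ![E3, E4, E2] (by funext m; fin_cases m <;> rfl)
  fin_cases m
  · exact ⟨(jMidE_act_up_iff M x b w t z a τ 0 hσ ha' true false 3).2 (by decide), rfl⟩
  · exact ⟨(jMidE_act_up_iff M x b w t z a τ 0 hσ ha' true false 4).2 (by decide), rfl⟩
  · exact ⟨(jMidE_act_up_iff M x b w t z a τ 0 hσ ha' true false 2).2 (by decide), rfl⟩

/-- **One-line reading of the exit letter `lo 3`** under `glFirstK2B`: the exit line `w_0 → z_0` of the start level
(slot `3`, (4.57)). [cite: FitznerVanDerHofstad2017, §4.2 (4.10), (4.18) (arXiv:1506.07977v2 p. 35); (4.57) (p. 41)] -/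
theorem junF_firstK2B_lo_le₁ (EB X0 X1 X2 X3 E0 E1 E2 E3 E4 : Set (BondConfig (Site d))) :
    junF p M x b w t z a τ (0 : Fin (M + 1)).castSucc glFirstK2B true false (firstEvS EB X0 X1 X2 X3 E0 E1 E2 E3 E4)
        (.lo 3) ≤
      piPerc d p 2 (genDisjOcc ![X3] ![0]) := by
  refine junF_le_of_lines p M x b w t z a τ (0 : Fin (M + 1)).castSucc glFirstK2B true false _ (JIdx.lo 3)
    ![JIdx.lo 3] (by decide) (fun m => ?_) ![0] (fun m => by fin_cases m; rfl)
    ![X3] (by funext m; fin_cases m; rfl)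
  fin_cases m
  exact ⟨(jFirst_act_lo_iff M x b w t z a τ true false 3).2 (by decide), rfl⟩

end Letter

/-! ### C. The cores -/

section Packages

variable (p : unitInterval) (M : ℕ) (x : Site d) (b : Fin (M + 2) → Site d × Site d) (w t z : Fin (M + 2) → Site d)
  (a : Fin (M + 2) → Fin 3 ⊕ Unit) (c : Fin 3 ⊕ Unit) (τ : Fin (M + 1) → Bool × Fin 3)

/-- **Core, product grouping at a middle junction**: upgraded events for the five lines of level `k + 1` and the
exit line of level `k` containing the joint witnesses, a bond event `EB ∋ {b_k}`, and bounds of the three letters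
`up 2 ≤ T₁`, `xb ≤ T₂`, `lo 5 ≤ T₃` give a package with target `T₁ * T₂ * T₃`.
[cite: FitznerVanDerHofstad2017, §6.1 (6.4) (arXiv:1506.07977v2 p. 58); §4.4 (4.58)–(4.60), (4.65) (pp. 41, 43); §4.2 (4.18) (p. 35)] -/
theorem nonempty_jPkg_midK2B_core (i i₀ : Fin (M + 1)) (hk : i₀.succ = i.castSucc) (hσ : (τ i).1 = true)
    {a₀ a' : Fin 3} (ha : a i.castSucc = Sum.inl a₀) (ha' : a i.succ = Sum.inl a')
    (EB E0 E1 E2 E3 E4 X5 : Set (BondConfig (Site d))) (hfB : IsFinitary EB) (h0 : IsFinitary E0)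
    (h1 : IsFinitary E1) (h2 : IsFinitary E2) (h3 : IsFinitary E3) (h4 : IsFinitary E4) (h5 : IsFinitary X5)
    (hB : ({s((b i.castSucc).1, (b i.castSucc).2)} : Set (Sym2 (Site d))) ∈ EB)
    (hmem : ∀ ω K₀, JFacts M x b w t z a c τ ω K₀ →
      K₀ i.castSucc.succ 0 ∈ E0 ∧ K₀ i.castSucc.succ 1 ∈ E1 ∧ K₀ i.castSucc.succ 2 ∈ E2 ∧
        K₀ i.castSucc.succ 3 ∈ E3 ∧ K₀ i.castSucc.succ 4 ∈ E4 ∧ K₀ i.castSucc.castSucc 5 ∈ X5)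
    {T₁ T₂ T₃ : ℝ≥0∞}
    (hrow₁ : junF p M x b w t z a τ i.castSucc glMidK2B true false (midEv EB E0 E1 E2 E3 E4 X5) (.up 2) ≤ T₁)
    (hrow₂ : junF p M x b w t z a τ i.castSucc glMidK2B true false (midEv EB E0 E1 E2 E3 E4 X5) .xb ≤ T₂)
    (hrow₃ : junF p M x b w t z a τ i.castSucc glMidK2B true false (midEv EB E0 E1 E2 E3 E4 X5) (.lo 5) ≤ T₃) :
    Nonempty (JPkg p (jctx M x b w t z a τ i.castSucc) (JFacts M x b w t z a c τ) (T₁ * T₂ * T₃)) := by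
  refine nonempty_jPkg_of_joint p i.castSucc glMidK2B true (midEv EB E0 E1 E2 E3 E4 X5)
    (isFinitary_midEv _ _ _ _ _ _ _ hfB h0 h1 h2 h3 h4 h5) (fun _ => by rw [midEv_xb]; exact hB)
    (fun j j' _ _ hg => absurd hg (glMidK2B_lo_ne_up j j'))
    (fun ω K₀ hF => ⟨fun j hj => ?_, fun j hj => ?_⟩) ?_
  · obtain rfl := (jMidOpen_act_lo_iff M x b w t z a τ i i₀ hk ha true false j).1 hj
    rw [midEv_lo_five]
    exact (hmem ω K₀ hF).2.2.2.2.2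
  · have hj5 : j ≠ 5 := (jMidE_act_up_iff M x b w t z a τ i hσ ha' true false j).1 hj
    obtain ⟨m0, m1, m2, m3, m4, -⟩ := hmem ω K₀ hF
    exact mem_midEv_up _ _ _ _ _ _ _ m0 m1 m2 m3 m4 j hj5
  · exact (prod_junF_le₃ p M x b w t z a τ i.castSucc glMidK2B true false _
      (show JIdx.up 2 ≠ JIdx.xb by decide) (show JIdx.up 2 ≠ JIdx.lo 5 by decide)
      (show JIdx.xb ≠ JIdx.lo 5 by decide)).trans (mul_le_mul' (mul_le_mul' hrow₁ hrow₂) hrow₃)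

/-- **Core, product grouping at the first junction**: start-letter data, events for the exit line of the start
level and all five lines of level `1`, a bond event `EB ∋ {b_0}`, and bounds of the letters `lo 0 ≤ T₀`,
`up 2 ≤ T₁`, `xb ≤ T₂`, `lo 3 ≤ T₃` give a package with target `T₀ * (T₁ * T₂ * T₃)`.
[cite: FitznerVanDerHofstad2017, §6.1 (6.4)–(6.5) (arXiv:1506.07977v2 p. 58); §4.4 (4.57)–(4.60), (4.65) (pp. 41, 43); §4.2 (4.18) (p. 35)] -/
theorem nonempty_jPkg_firstK2B_core (hσ : (τ 0).1 = true) {a' : Fin 3} (ha' : a (0 : Fin (M + 1)).succ = Sum.inl a')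
    (EB X0 X1 X2 X3 E0 E1 E2 E3 E4 : Set (BondConfig (Site d))) (hfB : IsFinitary EB) (f0 : IsFinitary X0)
    (f1 : IsFinitary X1) (f2 : IsFinitary X2) (f3 : IsFinitary X3) (h0 : IsFinitary E0) (h1 : IsFinitary E1)
    (h2 : IsFinitary E2) (h3 : IsFinitary E3) (h4 : IsFinitary E4)
    (hB : ({s((b (0 : Fin (M + 1)).castSucc).1, (b (0 : Fin (M + 1)).castSucc).2)} : Set (Sym2 (Site d))) ∈ EB)
    (hmem : ∀ ω K₀, JFacts M x b w t z a c τ ω K₀ →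
      K₀ (0 : Fin (M + 1)).castSucc.castSucc 0 ∈ X0 ∧ K₀ (0 : Fin (M + 1)).castSucc.castSucc 1 ∈ X1 ∧
        K₀ (0 : Fin (M + 1)).castSucc.castSucc 2 ∈ X2 ∧ K₀ (0 : Fin (M + 1)).castSucc.castSucc 3 ∈ X3 ∧
        K₀ (0 : Fin (M + 1)).castSucc.succ 0 ∈ E0 ∧ K₀ (0 : Fin (M + 1)).castSucc.succ 1 ∈ E1 ∧
        K₀ (0 : Fin (M + 1)).castSucc.succ 2 ∈ E2 ∧ K₀ (0 : Fin (M + 1)).castSucc.succ 3 ∈ E3 ∧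
        K₀ (0 : Fin (M + 1)).castSucc.succ 4 ∈ E4)
    {T₀ T₁ T₂ T₃ : ℝ≥0∞}
    (hrow₀ : junF p M x b w t z a τ (0 : Fin (M + 1)).castSucc glFirstK2B true false
      (firstEvS EB X0 X1 X2 X3 E0 E1 E2 E3 E4) (.lo 0) ≤ T₀)
    (hrow₁ : junF p M x b w t z a τ (0 : Fin (M + 1)).castSucc glFirstK2B true false
      (firstEvS EB X0 X1 X2 X3 E0 E1 E2 E3 E4) (.up 2) ≤ T₁)
    (hrow₂ : junF p M x b w t z a τ (0 : Fin (M + 1)).castSucc glFirstK2B true false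
      (firstEvS EB X0 X1 X2 X3 E0 E1 E2 E3 E4) .xb ≤ T₂)
    (hrow₃ : junF p M x b w t z a τ (0 : Fin (M + 1)).castSucc glFirstK2B true false
      (firstEvS EB X0 X1 X2 X3 E0 E1 E2 E3 E4) (.lo 3) ≤ T₃) :
    Nonempty (JPkg p (jctx M x b w t z a τ (0 : Fin (M + 1)).castSucc) (JFacts M x b w t z a c τ)
      (T₀ * (T₁ * T₂ * T₃))) := by
  rw [← mul_assoc, ← mul_assoc]
  refine nonempty_jPkg_of_joint p (0 : Fin (M + 1)).castSucc glFirstK2B true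
    (firstEvS EB X0 X1 X2 X3 E0 E1 E2 E3 E4)
    (isFinitary_firstEvS _ _ _ _ _ _ _ _ _ _ hfB f0 f1 f2 f3 h0 h1 h2 h3 h4)
    (fun _ => by rw [firstEvS_xb]; exact hB)
    (fun j j' _ _ hg => absurd hg (glFirstK2B_lo_ne_up j j'))
    (fun ω K₀ hF => ⟨fun j hj => ?_, fun j hj => ?_⟩) ?_
  · have hj4 : (j : ℕ) < 4 := (jFirst_act_lo_iff M x b w t z a τ true false j).1 hj
    obtain ⟨m0, m1, m2, m3, -⟩ := hmem ω K₀ hF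
    exact mem_firstEvS_lo _ _ _ _ _ _ _ _ _ _ m0 m1 m2 m3 j hj4
  · have hj5 : j ≠ 5 := (jMidE_act_up_iff M x b w t z a τ 0 hσ ha' true false j).1 hj
    obtain ⟨-, -, -, -, m0, m1, m2, m3, m4⟩ := hmem ω K₀ hF
    exact mem_firstEvS_up _ _ _ _ _ _ _ _ _ _ m0 m1 m2 m3 m4 j hj5
  · exact (prod_junF_le₄ p M x b w t z a τ (0 : Fin (M + 1)).castSucc glFirstK2B true false _
      (show JIdx.lo 0 ≠ JIdx.up 2 by decide) (show JIdx.lo 0 ≠ JIdx.xb by decide)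
      (show JIdx.lo 0 ≠ JIdx.lo 3 by decide) (show JIdx.up 2 ≠ JIdx.xb by decide)
      (show JIdx.up 2 ≠ JIdx.lo 3 by decide) (show JIdx.xb ≠ JIdx.lo 3 by decide)).trans
      (mul_le_mul' (mul_le_mul' (mul_le_mul' hrow₀ hrow₁) hrow₂) hrow₃)

/-! ### D. The cells -/

/-- **Row `(1, ≥2 | d ≥ 2)` of `B^{(2)}` in PRODUCT form at a middle junction `k = i₀ + 1`**: for
`t_k ≠ u_{k+1}` (`F″`), inner class `2`, start class `1` (`u_k ∼ w_k`), a package with target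
`2dD(w_k − u_k) · T_{≥1,≥1,≥2}(u_{k+1} − t_k, z_k − t_k, 0) · T_{≥1,≥0,1̲}(w_{k+1} − t_k, b̄_k − t_k, u_k − t_k) ·
τ_{≥0}(z_k − w_k)`; for `a′ ≤ 1` the piece is empty (clause (8)).
[cite: FitznerVanDerHofstad2017, App. B Table "B^{(2),ι,a,b}", row a = 1, b ≥ 2, d_{C̃}(w,u) ≥ 2 (arXiv:1506.07977v2 p. 76); §5.1 (5.4) third term (p. 48); §4.2 (4.10), (4.16)–(4.18) (pp. 35–36); §6.1 (6.4) "Case a = 1", "Case b ≥ 2" (pp. 58–59)] -/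
theorem nonempty_jPkg_midE_K2B (i i₀ : Fin (M + 1)) (hk : i₀.succ = i.castSucc) (κ : Fin d × Bool)
    (hb : (b i.castSucc).2 = (b i.castSucc).1 + stepVec κ) (hσ : (τ i).1 = true) (hc2 : (τ i).2 = 2)
    (ha : a i.castSucc = Sum.inl 1) {a' : Fin 3} (ha' : a i.succ = Sum.inl a')
    (hty : t i.castSucc ≠ (b i.succ).1) :
    Nonempty (JPkg p (jctx M x b w t z a τ i.castSucc) (JFacts M x b w t z a c τ)
      (twoDD (w i.castSucc - (b i.castSucc).1) *
        (Letters.perc d p).T (ge 1) (ge 1) (ge 2) ((b i.succ).1 - t i.castSucc) (z i.castSucc - t i.castSucc) 0 *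
        (Letters.perc d p).T (ge 1) (ge 0) (eq 1) (w i.succ - t i.castSucc) ((b i.castSucc).2 - t i.castSucc)
          ((b i.castSucc).1 - t i.castSucc) *
        (Letters.perc d p).tau (ge 0) (z i.castSucc - w i.castSucc))) := by
  -- exit class `a′ ≤ 1` above: the piece is empty (clause (8))
  by_cases h2 : a' = 2
  swap
  · exact nonempty_jPkg_of_sharp p c _ i hσ ha' h2 hty _
  subst h2
  -- degenerate parameters: the piece is empty
  by_cases hP : z i.castSucc ≠ (b i.succ).1 ∧ w i.succ ≠ t i.castSucc ∧ t i.castSucc ≠ z i.castSucc ∧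
      (zdGraph d).Adj (b i.castSucc).1 (w i.castSucc)
  swap
  · refine ⟨JPkg.vacuous p _ _ (fun ω K₀ hF => hP ?_) _⟩
    obtain ⟨⟨-, hzy, hwt, -, -, -, -, -, hw1⟩, htz, -⟩ := midEProper_facts hF i i₀ hk hσ ha ha' hty hc2
    exact ⟨hzy, hwt, htz, hw1 rfl⟩
  obtain ⟨hzy, hwt, htz, hadw⟩ := hP
  -- start class `1`: `2dD(w_k − u_k) = 1`
  obtain ⟨κ', hκ'⟩ := (zdGraph_adj_iff_stepVec _ _).1 hadw
  have h2v : twoDD (w i.castSucc - (b i.castSucc).1) = 1 := by rw [hκ', add_sub_cancel_left, twoDD_stepVec]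
  have huv : (b i.castSucc).1 ≠ (b i.castSucc).2 := by
    rw [hb]; exact (zdGraph_adj_iff_stepVec _ _ |>.2 ⟨κ, rfl⟩).ne
  rw [h2v, one_mul]
  refine nonempty_jPkg_midK2B_core p M x b w t z a c τ i i₀ hk hσ ha ha'
    (event (eq 1) (b i.castSucc).2 (b i.castSucc).1) (event (ge 0) (w i.succ) (b i.castSucc).2)
    (event (ge 1) (t i.castSucc) (w i.succ)) (event (ge 2) (z i.castSucc) (t i.castSucc))
    (event (ge 1) (t i.castSucc) (b i.succ).1) (event (ge 1) (b i.succ).1 (z i.castSucc))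
    (event (ge 0) (w i.castSucc) (z i.castSucc))
    (isFinitary_event _ _ _) (isFinitary_event _ _ _) (isFinitary_event _ _ _) (isFinitary_event _ _ _)
    (isFinitary_event _ _ _) (isFinitary_event _ _ _) (isFinitary_event _ _ _)
    (by rw [event_comm]; exact singleton_mem_event_eq_one huv) (fun ω K₀ hF => ?_) ?_ ?_ ?_
  · obtain ⟨h0, h1, h2, h3, h4⟩ := hF.conn_midE i hσ ha'
    obtain ⟨-, -, hcl⟩ := midEProper_facts hF i i₀ hk hσ ha ha' hty hc2
    have h5 := hF.conn_exit i i₀ hk ha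
    refine ⟨?_, ?_, ?_, ?_, ?_, ?_⟩
    · rw [event_comm, event_ge]; exact mem_openConnGe_zero_of_mem h0
    · rw [event_comm, event_ge]; exact mem_openConnGe_one_of_ne h1 hwt
    · rw [event_comm, event_ge]
      exact mem_openConnGe_two_of_notMem h2 htz fun hm => hcl (hF.witness_subset _ 2 hm)
    · rw [event_ge]; exact mem_openConnGe_one_of_ne h3 hty
    · rw [event_comm, event_ge]; exact mem_openConnGe_one_of_ne h4 hzy
    · rw [event_ge]; exact mem_openConnGe_zero_of_mem h5
  · -- the triangle `t → u′ → z ⇒ t`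
    refine (junF_midK2B_up_le₃ p M x b w t z a τ i hσ ha' _ _ _ _ _ _ _).trans ?_
    have hT := piPerc_genDisjOcc_le_T p (ge 1) (ge 1) (ge 2) (t i.castSucc) (b i.succ).1 (z i.castSucc)
      (t i.castSucc) (![1, 1, 1] : Fin 3 → Fin 2)
    rwa [sub_self] at hT
  · -- the chain `t → w′ → b̄ → u`
    exact (junF_midK2B_xb_le₃ p M x b w t z a τ i hσ ha' _ _ _ _ _ _ _).trans
      (piPerc_genDisjOcc_le_T p (ge 1) (ge 0) (eq 1) _ _ _ _ _)
  · -- the exit line `w → z`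
    exact (junF_midK2B_lo_le₁ p M x b w t z a τ i i₀ hk ha _ _ _ _ _ _ _).trans
      (piPerc_genDisjOcc_one_le_tau p (ge 0) _ _ _)

/-- **Row `(1, ≥2 | d ≥ 2)` in product form, literal base-`u_k` coordinates** (the argument pattern of the
packet's product-form target at `(u, w, t, z, w′, u′) = (u_k, w_k, t_k, z_k, w_{k+1}, u_{k+1})`, `e_κ = b̄_k − u_k`):
`2dD(w−u) · T_{≥1,≥1,≥2}((u′−u)−(t−u), (z−u)−(t−u), 0) · T_{≥1,≥0,1̲}((w′−u)−(t−u), e_κ−(t−u), −(t−u)) ·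
τ_{≥0}((z−u)−(w−u))`.
[cite: FitznerVanDerHofstad2017, App. B Table "B^{(2),ι,a,b}", row a = 1, b ≥ 2, d_{C̃}(w,u) ≥ 2 (arXiv:1506.07977v2 p. 76); §5.1 (5.4) (p. 48)] -/
theorem nonempty_jPkg_midE_K2B_lit (i i₀ : Fin (M + 1)) (hk : i₀.succ = i.castSucc) (κ : Fin d × Bool)
    (hb : (b i.castSucc).2 = (b i.castSucc).1 + stepVec κ) (hσ : (τ i).1 = true) (hc2 : (τ i).2 = 2)
    (ha : a i.castSucc = Sum.inl 1) {a' : Fin 3} (ha' : a i.succ = Sum.inl a')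
    (hty : t i.castSucc ≠ (b i.succ).1) :
    Nonempty (JPkg p (jctx M x b w t z a τ i.castSucc) (JFacts M x b w t z a c τ)
      (twoDD (w i.castSucc - (b i.castSucc).1) *
        (Letters.perc d p).T (ge 1) (ge 1) (ge 2)
          (((b i.succ).1 - (b i.castSucc).1) - (t i.castSucc - (b i.castSucc).1))
          ((z i.castSucc - (b i.castSucc).1) - (t i.castSucc - (b i.castSucc).1)) 0 *
        (Letters.perc d p).T (ge 1) (ge 0) (eq 1)
          ((w i.succ - (b i.castSucc).1) - (t i.castSucc - (b i.castSucc).1))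
          (stepVec κ - (t i.castSucc - (b i.castSucc).1)) (-(t i.castSucc - (b i.castSucc).1)) *
        (Letters.perc d p).tau (ge 0) ((z i.castSucc - (b i.castSucc).1) - (w i.castSucc - (b i.castSucc).1)))) := by
  have he : (b i.castSucc).2 - (b i.castSucc).1 = stepVec κ := by rw [hb, add_sub_cancel_left]
  rw [← he]
  simp only [sub_sub_sub_cancel_right, neg_sub]
  exact nonempty_jPkg_midE_K2B p M x b w t z a c τ i i₀ hk κ hb hσ hc2 ha ha' hty

/-- **Row `(1, ≥2 | d ≥ 2)` of `B^{(2)}` in PRODUCT form at the FIRST junction behind `P^{S,1}`**: for `t_0 ≠ u_1`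
(`F″`), inner class `2`, start class `1` (`u_0 ∼ w_0`), a package with target
`P^{S,1}(u_0, w_0) · (2dD(w_0 − u_0) · T_{≥1,≥1,≥2}(u_1 − t_0, z_0 − t_0, 0) · T_{≥1,≥0,1̲}(w_1 − t_0, b̄_0 − t_0,
u_0 − t_0) · τ_{≥0}(z_0 − w_0))`; `a_1 ≤ 1`: empty piece.
[cite: FitznerVanDerHofstad2017, App. B Table "B^{(2),ι,a,b}", row a = 1, b ≥ 2, d_{C̃}(w,u) ≥ 2 (arXiv:1506.07977v2 p. 76); §5.1 (5.2)–(5.4) (pp. 46–48); §6.1 (6.4)–(6.5) "Case a = 1", "Case b ≥ 2" (pp. 58–59)] -/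
theorem nonempty_jPkg_firstE_K2B (κ : Fin d × Bool)
    (hb : (b (0 : Fin (M + 1)).castSucc).2 = (b (0 : Fin (M + 1)).castSucc).1 + stepVec κ) (hσ : (τ 0).1 = true)
    (hc2 : (τ 0).2 = 2) (ha : a (0 : Fin (M + 1)).castSucc = Sum.inl 1) {a' : Fin 3}
    (ha' : a (0 : Fin (M + 1)).succ = Sum.inl a') (hty : t (0 : Fin (M + 1)).castSucc ≠ (b (0 : Fin (M + 1)).succ).1) :
    Nonempty (JPkg p (jctx M x b w t z a τ (0 : Fin (M + 1)).castSucc) (JFacts M x b w t z a c τ)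
      (blockPS (Letters.perc d p) 1 (b (0 : Fin (M + 1)).castSucc).1 (w (0 : Fin (M + 1)).castSucc) *
        (twoDD (w (0 : Fin (M + 1)).castSucc - (b (0 : Fin (M + 1)).castSucc).1) *
          (Letters.perc d p).T (ge 1) (ge 1) (ge 2) ((b (0 : Fin (M + 1)).succ).1 - t (0 : Fin (M + 1)).castSucc)
            (z (0 : Fin (M + 1)).castSucc - t (0 : Fin (M + 1)).castSucc) 0 *
          (Letters.perc d p).T (ge 1) (ge 0) (eq 1) (w (0 : Fin (M + 1)).succ - t (0 : Fin (M + 1)).castSucc)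
            ((b (0 : Fin (M + 1)).castSucc).2 - t (0 : Fin (M + 1)).castSucc)
            ((b (0 : Fin (M + 1)).castSucc).1 - t (0 : Fin (M + 1)).castSucc) *
          (Letters.perc d p).tau (ge 0) (z (0 : Fin (M + 1)).castSucc - w (0 : Fin (M + 1)).castSucc)))) := by
  -- exit class `a′ ≤ 1` above: the piece is empty (clause (8))
  by_cases h2 : a' = 2
  swap
  · exact nonempty_jPkg_of_sharp p c _ 0 hσ ha' h2 hty _
  subst h2
  -- degenerate parameters: the piece is empty
  by_cases hP : z (0 : Fin (M + 1)).castSucc ≠ (b (0 : Fin (M + 1)).succ).1 ∧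
      w (0 : Fin (M + 1)).succ ≠ t (0 : Fin (M + 1)).castSucc ∧
      t (0 : Fin (M + 1)).castSucc ≠ z (0 : Fin (M + 1)).castSucc ∧
      ((b (0 : Fin (M + 1)).castSucc).1 = 0 → w (0 : Fin (M + 1)).castSucc = 0) ∧
      (zdGraph d).Adj (b (0 : Fin (M + 1)).castSucc).1 (w (0 : Fin (M + 1)).castSucc)
  swap
  · refine ⟨JPkg.vacuous p _ _ (fun ω K₀ hF => hP ?_) _⟩
    obtain ⟨⟨-, hzy, hwt, -, -, -, -, hcan, -, hw1, -⟩, htz, -⟩ :=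
      firstEProper_facts M x b w t z a c τ hF hσ ha ha' hty hc2
    exact ⟨hzy, hwt, htz, hcan, hw1 rfl⟩
  obtain ⟨hzy, hwt, htz, hcan, hadw⟩ := hP
  -- start class `1`: `2dD(w_0 − u_0) = 1`
  obtain ⟨κ', hκ'⟩ := (zdGraph_adj_iff_stepVec _ _).1 hadw
  have h2v : twoDD (w (0 : Fin (M + 1)).castSucc - (b (0 : Fin (M + 1)).castSucc).1) = 1 := by
    rw [hκ', add_sub_cancel_left, twoDD_stepVec]
  have huv : (b (0 : Fin (M + 1)).castSucc).1 ≠ (b (0 : Fin (M + 1)).castSucc).2 := by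
    rw [hb]; exact (zdGraph_adj_iff_stepVec _ _ |>.2 ⟨κ, rfl⟩).ne
  rw [h2v, one_mul]
  obtain ⟨X0, X1, X2, f0, f1, f2, hmem₀, hrow₀⟩ :=
    first_startLetter_gl p M x b w t z a c τ glFirstK2B true false (.lo 0) rfl rfl rfl ha hcan
      (fun h => absurd h (by decide)) (fun _ => hadw) (fun h => absurd h (by decide))
  refine nonempty_jPkg_firstK2B_core p M x b w t z a c τ hσ ha'
    (event (eq 1) (b (0 : Fin (M + 1)).castSucc).2 (b (0 : Fin (M + 1)).castSucc).1) X0 X1 X2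
    (event (ge 0) (w (0 : Fin (M + 1)).castSucc) (z (0 : Fin (M + 1)).castSucc))
    (event (ge 0) (w (0 : Fin (M + 1)).succ) (b (0 : Fin (M + 1)).castSucc).2)
    (event (ge 1) (t (0 : Fin (M + 1)).castSucc) (w (0 : Fin (M + 1)).succ))
    (event (ge 2) (z (0 : Fin (M + 1)).castSucc) (t (0 : Fin (M + 1)).castSucc))
    (event (ge 1) (t (0 : Fin (M + 1)).castSucc) (b (0 : Fin (M + 1)).succ).1)
    (event (ge 1) (b (0 : Fin (M + 1)).succ).1 (z (0 : Fin (M + 1)).castSucc))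
    (isFinitary_event _ _ _) f0 f1 f2 (isFinitary_event _ _ _) (isFinitary_event _ _ _) (isFinitary_event _ _ _)
    (isFinitary_event _ _ _) (isFinitary_event _ _ _) (isFinitary_event _ _ _)
    (by rw [event_comm]; exact singleton_mem_event_eq_one huv) (fun ω K₀ hF => ?_) (hrow₀ _ rfl rfl rfl)
    ?_ ?_ ?_
  · obtain ⟨h0, h1, h2, h3, h4⟩ := hF.conn_midE 0 hσ ha'
    obtain ⟨-, -, hcl⟩ := firstEProper_facts M x b w t z a c τ hF hσ ha ha' hty hc2
    obtain ⟨-, -, h5⟩ := hF.conn_first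
    refine ⟨(hmem₀ ω K₀ hF).1, (hmem₀ ω K₀ hF).2.1, (hmem₀ ω K₀ hF).2.2, ?_, ?_, ?_, ?_, ?_, ?_⟩
    · rw [event_ge]; exact mem_openConnGe_zero_of_mem h5
    · rw [event_comm, event_ge]; exact mem_openConnGe_zero_of_mem h0
    · rw [event_comm, event_ge]; exact mem_openConnGe_one_of_ne h1 hwt
    · rw [event_comm, event_ge]
      exact mem_openConnGe_two_of_notMem h2 htz fun hm => hcl (hF.witness_subset _ 2 hm)
    · rw [event_ge]; exact mem_openConnGe_one_of_ne h3 hty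
    · rw [event_comm, event_ge]; exact mem_openConnGe_one_of_ne h4 hzy
  · -- the triangle `t_0 → u_1 → z_0 ⇒ t_0`
    refine (junF_firstK2B_up_le₃ p M x b w t z a τ hσ ha' _ _ _ _ _ _ _ _ _ _).trans ?_
    have hT := piPerc_genDisjOcc_le_T p (ge 1) (ge 1) (ge 2) (t (0 : Fin (M + 1)).castSucc)
      (b (0 : Fin (M + 1)).succ).1 (z (0 : Fin (M + 1)).castSucc) (t (0 : Fin (M + 1)).castSucc)
      (![1, 1, 1] : Fin 3 → Fin 2)
    rwa [sub_self] at hT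
  · -- the chain `t_0 → w_1 → b̄_0 → u_0`
    exact (junF_firstK2B_xb_le₃ p M x b w t z a τ hσ ha' _ _ _ _ _ _ _ _ _ _).trans
      (piPerc_genDisjOcc_le_T p (ge 1) (ge 0) (eq 1) _ _ _ _ _)
  · -- the exit line `w_0 → z_0` of the start level
    exact (junF_firstK2B_lo_le₁ p M x b w t z a τ _ _ _ _ _ _ _ _ _ _).trans
      (piPerc_genDisjOcc_one_le_tau p (ge 0) _ _ _)

/-- **Row `(1, ≥2 | d ≥ 2)` in product form at the first junction, literal base-`u_0` coordinates**, behind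
`P^{S,1}(u_0, w_0)`.
[cite: FitznerVanDerHofstad2017, App. B Table "B^{(2),ι,a,b}", row a = 1, b ≥ 2, d_{C̃}(w,u) ≥ 2 (arXiv:1506.07977v2 p. 76); §5.1 (5.4) (p. 48); §6.1 (6.5) (p. 58)] -/
theorem nonempty_jPkg_firstE_K2B_lit (κ : Fin d × Bool)
    (hb : (b (0 : Fin (M + 1)).castSucc).2 = (b (0 : Fin (M + 1)).castSucc).1 + stepVec κ) (hσ : (τ 0).1 = true)
    (hc2 : (τ 0).2 = 2) (ha : a (0 : Fin (M + 1)).castSucc = Sum.inl 1) {a' : Fin 3}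
    (ha' : a (0 : Fin (M + 1)).succ = Sum.inl a') (hty : t (0 : Fin (M + 1)).castSucc ≠ (b (0 : Fin (M + 1)).succ).1) :
    Nonempty (JPkg p (jctx M x b w t z a τ (0 : Fin (M + 1)).castSucc) (JFacts M x b w t z a c τ)
      (blockPS (Letters.perc d p) 1 (b (0 : Fin (M + 1)).castSucc).1 (w (0 : Fin (M + 1)).castSucc) *
        (twoDD (w (0 : Fin (M + 1)).castSucc - (b (0 : Fin (M + 1)).castSucc).1) *
          (Letters.perc d p).T (ge 1) (ge 1) (ge 2)
            (((b (0 : Fin (M + 1)).succ).1 - (b (0 : Fin (M + 1)).castSucc).1) -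
              (t (0 : Fin (M + 1)).castSucc - (b (0 : Fin (M + 1)).castSucc).1))
            ((z (0 : Fin (M + 1)).castSucc - (b (0 : Fin (M + 1)).castSucc).1) -
              (t (0 : Fin (M + 1)).castSucc - (b (0 : Fin (M + 1)).castSucc).1)) 0 *
          (Letters.perc d p).T (ge 1) (ge 0) (eq 1)
            ((w (0 : Fin (M + 1)).succ - (b (0 : Fin (M + 1)).castSucc).1) -
              (t (0 : Fin (M + 1)).castSucc - (b (0 : Fin (M + 1)).castSucc).1))
            (stepVec κ - (t (0 : Fin (M + 1)).castSucc - (b (0 : Fin (M + 1)).castSucc).1))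
            (-(t (0 : Fin (M + 1)).castSucc - (b (0 : Fin (M + 1)).castSucc).1)) *
          (Letters.perc d p).tau (ge 0)
            ((z (0 : Fin (M + 1)).castSucc - (b (0 : Fin (M + 1)).castSucc).1) -
              (w (0 : Fin (M + 1)).castSucc - (b (0 : Fin (M + 1)).castSucc).1))))) := by
  have he : (b (0 : Fin (M + 1)).castSucc).2 - (b (0 : Fin (M + 1)).castSucc).1 = stepVec κ := by
    rw [hb, add_sub_cancel_left]
  rw [← he]
  simp only [sub_sub_sub_cancel_right, neg_sub]
  exact nonempty_jPkg_firstE_K2B p M x b w t z a c τ κ hb hσ hc2 ha ha' hty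

end Packages

end Literature.Probability.FitznerVanDerHofstad2017

end
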